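import Literature.RepresentationTheory.BorelWallach2000.U11TranslationFunctors
import Literature.NumberTheory.Automorphic.GKModuleProd
import HarnessLib

/-!
# The translation functors on binary products: `X × Y ∈ 𝒞_{Zf}` / `𝒞_χ`, and `ψ(X × Y) ≅ ψX × ψY` (additivity)

Family `hodge`, lane `lit-hodgefound` (foundations library; seat `lit-hodgefound-p39`, generation 29, row g29-#15); topic
`RepresentationTheory/BorelWallach2000`, namespace `…BorelWallach2000.U11TranslProd`.  With g29-#14 (`GKModuleProd`: the product `X × Y` of
two `(𝔤, K)`-modules over the operator ring `R = GKRing G11` is a `(𝔤, K)`-module, componentwise data) the Zuckerman translation functors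
`ψ = ψ^{(μ′,λ′)}_{F_{m,n}}` of the lineage (`U11Transl.transl`, `translMap`) can be evaluated on binary products, and they are ADDITIVE:
**`translProdEquiv : ψX × ψY ≃ₗ[R] ψ(X × Y)`**, `(p, q) ↦ ψ(ι₁) p + ψ(ι₂) q`, with inverse `(ψ(π₁), ψ(π₂))` — injective because
`(ψ(π₁), ψ(π₂))` is a left inverse by functoriality (`ψ(π₁ι₁) = 1`, `ψ(π₁ι₂) = 0`, …), surjective because `ψ` is exact on
`0 → X → X × Y → Y → 0` (`U11Transl.exact_translMap`, for `X ∈ 𝒞_{Zf}`).  Also: `Z` and `C` act on every `R`-module through the ring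
elements `[Z]`, `c` (`U11HC.centerElt_smul`, `casimirElt_smul`), hence componentwise on `X × Y`, which gives **`isZCFinite_prod`** (`X, Y ∈ 𝒞_{Zf} ⟹
X × Y ∈ 𝒞_{Zf}`, annihilating polynomials multiply) and **`hasGenInfChar_prod`** (`X, Y ∈ 𝒞_χ ⟹ X × Y ∈ 𝒞_χ`, exponents add).  This is the
piece whose absence made g29-#6 phrase `ϑϑB ≅ ϑB ⊕ ϑB` through `coprod` maps.  Theorems and two definitions with bodies; 0 `sorry`, no
named fact (net debt 0, D-0026).

## The sources, verbatim

* A. W. Knapp, D. A. Vogan, *Cohomological Induction and Unitary Representations* (1995) [KnappVogan1995]: §VII.2 (7.13) (`Z(𝔤)`-finite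
  modules), Prop. 7.20 (b)–(c) («`𝒞_{Zf}(𝔤, K)` is closed under passage to submodules, quotients, and finite direct sums», the primary
  decomposition), (7.26a); §VII.8 (7.141) (`ψ`), Prop. 7.143 («`ψ` is covariant and exact»); Thm. 1.117 (c)–(d).
* A. Borel, N. Wallach (2000) [BorelWallach2000], 0 §2.5; II §1.3 (1) (the Casimir element).

## What is formalised

* §1 `subCenter_eq_smulEnd`, `subCasimir_eq_smulEnd`, `subCenter_pow_apply`, `subCasimir_pow_apply` (`(Z − μ)^k`, `(C − λ)^k` act through ring
  elements), **`isZCFinite_prod`**, **`hasGenInfChar_prod`**.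
* §2 `isGKModule_prod` (g29-#14, re-exported for `G11`), `translCoprod` (+ `_apply`), `translMap_snd_comp_inr`, `translMap_fst_comp_inl`,
  `translMap_snd_comp_inl`, `translMap_fst_comp_inr`, `prod_comp_translCoprod`, `translCoprod_injective`, `translCoprod_surjective`,
  **`translProdEquiv`** (+ `_apply`, `_symm_apply`), `length_transl_prod`.

NOT here: infinite direct sums; `P_χ(X × Y) = P_χ(X) × P_χ(Y)` as submodules (only through `ψ`); nothing here is a case of the Hodge conjecture.

Consumed by name: g29-#14 `GKRing.isGKModule_prod`; `U11Transl.transl`, `translMap`, `translMap_comp`, `translMap_id`, `translMap_zero`,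
`translMap_injective`, `exact_translMap` (`U11TranslationFunctors`); `U11HC.IsZCFinite`, `casimirElt`, `centerElt`, `aeval_casimirElt_smul`,
`aeval_centerElt_smul`, `casimirElt_smul`, `centerElt_smul` (`U11HarishChandraModules`); `U11Primary.HasGenInfChar`; `GKRing.smulEnd`; Mathlib
`Function.Exact.inl_snd`, `LinearMap.coprod`, `LinearMap.prod`, `LinearMap.snd_comp_inr`, `Module.length_prod`, `LinearEquiv.ofBijective`.

## References

* A. W. Knapp, D. A. Vogan, *Cohomological Induction and Unitary Representations*, Princeton Math. Ser. 45 (1995), §VII.2 (7.13), Prop. 7.20,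
  (7.26a); §VII.8 (7.141), Prop. 7.143; Thm. 1.117. [KnappVogan1995]
* A. Borel, N. Wallach, *Continuous Cohomology, Discrete Subgroups, and Representations of Reductive Groups*, 2nd ed., AMS (2000), 0 §2.5;
  II §1.3. [BorelWallach2000]
-/

noncomputable section

open scoped Matrix ComplexConjugate TensorProduct
open Polynomial

namespace Literature.RepresentationTheory.BorelWallach2000

open Literature.Algebra.Lie Literature.Algebra.Lie.ChevalleyEilenberg
open Literature.NumberTheory.Automorphic
open Literature.RepresentationTheory.KonnoKonno2007 Literature.RepresentationTheory.KonnoKonno2007.RealDualPair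
open Literature.RepresentationTheory.KonnoKonno2007.RealDualPair.UForm
open U11HolDS

-- carriers `↥W` over `GKRing G11` with their `ℂ`-structures (as in `GKModuleRing` §7–§8)
set_option maxSynthPendingDepth 4

namespace U11TranslProd

open U11FinRep (Fm lieAct kAct)
open U11HC (IsZCFinite casimirElt centerElt)
open U11Primary (HasGenInfChar primary)
open U11Transl (tensorFin transl translMap isGKModule_transl)

/-! ## §1 The operator ring on a product; `Z(𝔤)`-finiteness and generalized infinitesimal characters of `X × Y` -/

section Scalars

variable (M : Type*) [AddCommGroup M] [Module ℂ M] [Module (GKRing G11) M] [IsScalarTower ℂ (GKRing G11) M]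

/-- `ρ𝔤(Z) − μ` is multiplication by the ring element `[Z] − μ`. [cite: KnappVogan1995, Thm. 1.117 (c), §VII.2 (7.26a)] -/
theorem subCenter_eq_smulEnd (μ : ℂ) :
    GKRing.actLie G11 M U11FinRep.zCenter - μ • (1 : Module.End ℂ M) = GKRing.smulEnd G11 M (centerElt - algebraMap ℂ (GKRing G11) μ) := by
  refine LinearMap.ext fun m => ?_
  rw [LinearMap.sub_apply, LinearMap.smul_apply, Module.End.one_apply, GKRing.smulEnd_apply, sub_smul, algebraMap_smul,
    U11HC.centerElt_smul]

/-- `C − λ` is multiplication by the ring element `c − λ`. [cite: KnappVogan1995, Thm. 1.117 (c), §VII.2 (7.26a)] [cite: BorelWallach2000, II §1.3 (1)] -/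
theorem subCasimir_eq_smulEnd (lam : ℂ) :
    upqCasimirOp (GKRing.actLie G11 M) - lam • (1 : Module.End ℂ M) = GKRing.smulEnd G11 M (casimirElt - algebraMap ℂ (GKRing G11) lam) := by
  refine LinearMap.ext fun m => ?_
  rw [LinearMap.sub_apply, LinearMap.smul_apply, Module.End.one_apply, GKRing.smulEnd_apply, sub_smul, algebraMap_smul,
    U11HC.casimirElt_smul]

/-- Powers: `(ρ𝔤(Z) − μ)^k = ([Z] − μ)^k •`. [cite: KnappVogan1995, §VII.2 (7.26a)] -/
theorem subCenter_pow_apply (μ : ℂ) (k : ℕ) (m : M) :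
    ((GKRing.actLie G11 M U11FinRep.zCenter - μ • (1 : Module.End ℂ M)) ^ k) m = (centerElt - algebraMap ℂ (GKRing G11) μ) ^ k • m := by
  rw [subCenter_eq_smulEnd, ← map_pow, GKRing.smulEnd_apply]

/-- Powers: `(C − λ)^k = (c − λ)^k •`. [cite: KnappVogan1995, §VII.2 (7.26a)] -/
theorem subCasimir_pow_apply (lam : ℂ) (k : ℕ) (m : M) :
    ((upqCasimirOp (GKRing.actLie G11 M) - lam • (1 : Module.End ℂ M)) ^ k) m = (casimirElt - algebraMap ℂ (GKRing G11) lam) ^ k • m := by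
  rw [subCasimir_eq_smulEnd, ← map_pow, GKRing.smulEnd_apply]

end Scalars

section Prod

variable {X : Type*} [AddCommGroup X] [Module ℂ X] [Module (GKRing G11) X] [IsScalarTower ℂ (GKRing G11) X]
variable {Y : Type*} [AddCommGroup Y] [Module ℂ Y] [Module (GKRing G11) Y] [IsScalarTower ℂ (GKRing G11) Y]

/-- **`X, Y ∈ 𝒞_{Zf} ⟹ X × Y ∈ 𝒞_{Zf}`**: if `p(C) = 0` on `X` and `q(C) = 0` on `Y` then `(pq)(C) = 0` on `X × Y` (and likewise for `Z`), since
`C` and `Z` act through ring elements, componentwise. [cite: KnappVogan1995, §VII.2 (7.13), Prop. 7.20 (b)] -/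
theorem isZCFinite_prod (hX : IsZCFinite (GKRing.actLie G11 X)) (hY : IsZCFinite (GKRing.actLie G11 Y)) :
    IsZCFinite (GKRing.actLie G11 (X × Y)) where
  casimir := by
    obtain ⟨p, hp, hpX⟩ := hX.casimir
    obtain ⟨q, hq, hqY⟩ := hY.casimir
    refine ⟨p * q, mul_ne_zero hp hq, LinearMap.ext fun v => ?_⟩
    rw [LinearMap.zero_apply, ← U11HC.aeval_casimirElt_smul]
    refine Prod.ext ?_ ?_
    · rw [Prod.smul_fst, Prod.fst_zero, U11HC.aeval_casimirElt_smul, mul_comm, map_mul, Module.End.mul_apply, hpX, LinearMap.zero_apply, map_zero]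
    · rw [Prod.smul_snd, Prod.snd_zero, U11HC.aeval_casimirElt_smul, map_mul, Module.End.mul_apply, hqY, LinearMap.zero_apply, map_zero]
  center := by
    obtain ⟨p, hp, hpX⟩ := hX.center
    obtain ⟨q, hq, hqY⟩ := hY.center
    refine ⟨p * q, mul_ne_zero hp hq, LinearMap.ext fun v => ?_⟩
    rw [LinearMap.zero_apply, ← U11HC.aeval_centerElt_smul]
    refine Prod.ext ?_ ?_
    · rw [Prod.smul_fst, Prod.fst_zero, U11HC.aeval_centerElt_smul, mul_comm, map_mul, Module.End.mul_apply, hpX, LinearMap.zero_apply, map_zero]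
    · rw [Prod.smul_snd, Prod.snd_zero, U11HC.aeval_centerElt_smul, map_mul, Module.End.mul_apply, hqY, LinearMap.zero_apply, map_zero]

/-- **`X, Y ∈ 𝒞_χ ⟹ X × Y ∈ 𝒞_χ`** for a generalized infinitesimal character `χ = (μ, λ)`: with exponents `n_X`, `n_Y` the exponent `n_X + n_Y`
works on `X × Y` (`(Z − μ)^k`, `(C − λ)^k` act through ring elements, componentwise). [cite: KnappVogan1995, §VII.2 (7.26a), Prop. 7.20 (b)–(c)] -/
theorem hasGenInfChar_prod {μ lam : ℂ} (hX : HasGenInfChar (GKRing.actLie G11 X) μ lam) (hY : HasGenInfChar (GKRing.actLie G11 Y) μ lam) :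
    HasGenInfChar (GKRing.actLie G11 (X × Y)) μ lam := by
  obtain ⟨a, ha⟩ := hX.out
  obtain ⟨b, hb⟩ := hY.out
  refine ⟨⟨a + b, fun v => ⟨Prod.ext ?_ ?_, Prod.ext ?_ ?_⟩⟩⟩
  · rw [subCenter_pow_apply, Prod.smul_fst, Prod.fst_zero, ← subCenter_pow_apply, add_comm, pow_add, Module.End.mul_apply, (ha v.1).1,
      map_zero]
  · rw [subCenter_pow_apply, Prod.smul_snd, Prod.snd_zero, ← subCenter_pow_apply, pow_add, Module.End.mul_apply, (hb v.2).1, map_zero]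
  · rw [subCasimir_pow_apply, Prod.smul_fst, Prod.fst_zero, ← subCasimir_pow_apply, add_comm, pow_add, Module.End.mul_apply, (ha v.1).2,
      map_zero]
  · rw [subCasimir_pow_apply, Prod.smul_snd, Prod.snd_zero, ← subCasimir_pow_apply, pow_add, Module.End.mul_apply, (hb v.2).2, map_zero]

/-! ## §2 `ψ(X × Y) ≅ ψX × ψY`: the translation functor is additive (split exactness) -/

variable (hX : IsGKModule G11 (GKRing.actK G11 X) (GKRing.actLie G11 X)) (hY : IsGKModule G11 (GKRing.actK G11 Y) (GKRing.actLie G11 Y))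

/-- The product `X × Y` is a `(𝔤, K)`-module over the operator ring (g29-#14 `GKRing.isGKModule_prod`). [cite: KnappVogan1995, §I.6, Thm. 1.117] -/
theorem isGKModule_prod (hX : IsGKModule G11 (GKRing.actK G11 X) (GKRing.actLie G11 X))
    (hY : IsGKModule G11 (GKRing.actK G11 Y) (GKRing.actLie G11 Y)) : IsGKModule G11 (GKRing.actK G11 (X × Y)) (GKRing.actLie G11 (X × Y)) :=
  GKRing.isGKModule_prod G11 X Y hX hY

/-- **`(ψ(ι₁), ψ(ι₂)) : ψX × ψY → ψ(X × Y)`** (`LinearMap.coprod` of the translates of the two injections).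
[cite: KnappVogan1995, §VII.8 (7.141), Thm. 1.117 (d)] -/
def translCoprod (m : ℕ) (n : ℤ) (μ' lam' : ℂ) :
    (transl hX m n μ' lam' × transl hY m n μ' lam') →ₗ[GKRing G11] transl (isGKModule_prod hX hY) m n μ' lam' :=
  (translMap hX (isGKModule_prod hX hY) m n μ' lam' (LinearMap.inl (GKRing G11) X Y)).coprod
    (translMap hY (isGKModule_prod hX hY) m n μ' lam' (LinearMap.inr (GKRing G11) X Y))

/-- `translCoprod (p, q) = ψ(ι₁) p + ψ(ι₂) q`. [cite: KnappVogan1995, §VII.8 (7.141)] -/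
theorem translCoprod_apply (m : ℕ) (n : ℤ) (μ' lam' : ℂ) (x : transl hX m n μ' lam' × transl hY m n μ' lam') :
    translCoprod hX hY m n μ' lam' x = translMap hX (isGKModule_prod hX hY) m n μ' lam' (LinearMap.inl (GKRing G11) X Y) x.1 +
      translMap hY (isGKModule_prod hX hY) m n μ' lam' (LinearMap.inr (GKRing G11) X Y) x.2 :=
  LinearMap.coprod_apply _ _ _

/-- `ψ(π₂) ∘ ψ(ι₂) = id` (functoriality). [cite: KnappVogan1995, §VII.8 (7.141), Thm. 1.117 (d)] -/
theorem translMap_snd_comp_inr (m : ℕ) (n : ℤ) (μ' lam' : ℂ) :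
    translMap (isGKModule_prod hX hY) hY m n μ' lam' (LinearMap.snd (GKRing G11) X Y) ∘ₗ
        translMap hY (isGKModule_prod hX hY) m n μ' lam' (LinearMap.inr (GKRing G11) X Y) = LinearMap.id :=
  (U11Transl.translMap_comp hY (isGKModule_prod hX hY) hY m n μ' lam' (LinearMap.snd (GKRing G11) X Y) (LinearMap.inr (GKRing G11) X Y)).symm.trans
    (by rw [LinearMap.snd_comp_inr, U11Transl.translMap_id])

/-- `ψ(π₁) ∘ ψ(ι₁) = id`. [cite: KnappVogan1995, §VII.8 (7.141), Thm. 1.117 (d)] -/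
theorem translMap_fst_comp_inl (m : ℕ) (n : ℤ) (μ' lam' : ℂ) :
    translMap (isGKModule_prod hX hY) hX m n μ' lam' (LinearMap.fst (GKRing G11) X Y) ∘ₗ
        translMap hX (isGKModule_prod hX hY) m n μ' lam' (LinearMap.inl (GKRing G11) X Y) = LinearMap.id :=
  (U11Transl.translMap_comp hX (isGKModule_prod hX hY) hX m n μ' lam' (LinearMap.fst (GKRing G11) X Y) (LinearMap.inl (GKRing G11) X Y)).symm.trans
    (by rw [LinearMap.fst_comp_inl, U11Transl.translMap_id])

/-- `ψ(π₂) ∘ ψ(ι₁) = 0`. [cite: KnappVogan1995, §VII.8 (7.141), Thm. 1.117 (d)] -/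
theorem translMap_snd_comp_inl (m : ℕ) (n : ℤ) (μ' lam' : ℂ) :
    translMap (isGKModule_prod hX hY) hY m n μ' lam' (LinearMap.snd (GKRing G11) X Y) ∘ₗ
        translMap hX (isGKModule_prod hX hY) m n μ' lam' (LinearMap.inl (GKRing G11) X Y) = 0 :=
  (U11Transl.translMap_comp hX (isGKModule_prod hX hY) hY m n μ' lam' (LinearMap.snd (GKRing G11) X Y) (LinearMap.inl (GKRing G11) X Y)).symm.trans
    (by rw [LinearMap.snd_comp_inl, U11Transl.translMap_zero])

/-- `ψ(π₁) ∘ ψ(ι₂) = 0`. [cite: KnappVogan1995, §VII.8 (7.141), Thm. 1.117 (d)] -/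
theorem translMap_fst_comp_inr (m : ℕ) (n : ℤ) (μ' lam' : ℂ) :
    translMap (isGKModule_prod hX hY) hX m n μ' lam' (LinearMap.fst (GKRing G11) X Y) ∘ₗ
        translMap hY (isGKModule_prod hX hY) m n μ' lam' (LinearMap.inr (GKRing G11) X Y) = 0 :=
  (U11Transl.translMap_comp hY (isGKModule_prod hX hY) hX m n μ' lam' (LinearMap.fst (GKRing G11) X Y) (LinearMap.inr (GKRing G11) X Y)).symm.trans
    (by rw [LinearMap.fst_comp_inr, U11Transl.translMap_zero])

/-- **`(ψ(π₁), ψ(π₂)) ∘ (ψ(ι₁), ψ(ι₂)) = id` on `ψX × ψY`**. [cite: KnappVogan1995, §VII.8 (7.141), Thm. 1.117 (d)] -/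
theorem prod_comp_translCoprod (m : ℕ) (n : ℤ) (μ' lam' : ℂ) :
    (translMap (isGKModule_prod hX hY) hX m n μ' lam' (LinearMap.fst (GKRing G11) X Y)).prod
        (translMap (isGKModule_prod hX hY) hY m n μ' lam' (LinearMap.snd (GKRing G11) X Y)) ∘ₗ translCoprod hX hY m n μ' lam' =
      LinearMap.id := by
  refine LinearMap.ext fun x => Prod.ext ?_ ?_
  · show translMap (isGKModule_prod hX hY) hX m n μ' lam' (LinearMap.fst (GKRing G11) X Y) (translCoprod hX hY m n μ' lam' x) = x.1
    rw [translCoprod_apply hX hY, map_add, ← LinearMap.comp_apply, translMap_fst_comp_inl hX hY, ← LinearMap.comp_apply, translMap_fst_comp_inr hX hY,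
      LinearMap.id_apply, LinearMap.zero_apply, add_zero]
  · show translMap (isGKModule_prod hX hY) hY m n μ' lam' (LinearMap.snd (GKRing G11) X Y) (translCoprod hX hY m n μ' lam' x) = x.2
    rw [translCoprod_apply hX hY, map_add, ← LinearMap.comp_apply, translMap_snd_comp_inl hX hY, ← LinearMap.comp_apply, translMap_snd_comp_inr hX hY,
      LinearMap.id_apply, LinearMap.zero_apply, zero_add]

/-- `translCoprod` is injective (it has the left inverse `(ψ(π₁), ψ(π₂))`). [cite: KnappVogan1995, §VII.8 (7.141)] -/
theorem translCoprod_injective (m : ℕ) (n : ℤ) (μ' lam' : ℂ) : Function.Injective (translCoprod hX hY m n μ' lam') :=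
  Function.LeftInverse.injective (g := (translMap (isGKModule_prod hX hY) hX m n μ' lam' (LinearMap.fst (GKRing G11) X Y)).prod
    (translMap (isGKModule_prod hX hY) hY m n μ' lam' (LinearMap.snd (GKRing G11) X Y))) (LinearMap.congr_fun (prod_comp_translCoprod hX hY m n μ' lam'))

/-- **`translCoprod` is surjective** for `X ∈ 𝒞_{Zf}`: `ψ` is exact on `0 → X → X × Y → Y → 0` (`U11Transl.exact_translMap`), so every
`y ∈ ψ(X × Y)` is `ψ(ι₁) p + ψ(ι₂)(ψ(π₂) y)`. [cite: KnappVogan1995, §VII.8 Prop. 7.143 (exactness), Thm. 1.117 (d)] -/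
theorem translCoprod_surjective (hXZ : IsZCFinite (GKRing.actLie G11 X)) (m : ℕ) (n : ℤ) (μ' lam' : ℂ) :
    Function.Surjective (translCoprod hX hY m n μ' lam') := fun y => by
  have hex := U11Transl.exact_translMap hX (isGKModule_prod hX hY) hY hXZ m n μ' lam' (LinearMap.inl (GKRing G11) X Y)
    (LinearMap.snd (GKRing G11) X Y) Function.Exact.inl_snd
  set q := translMap (isGKModule_prod hX hY) hY m n μ' lam' (LinearMap.snd (GKRing G11) X Y) y with hq
  have hker : translMap (isGKModule_prod hX hY) hY m n μ' lam' (LinearMap.snd (GKRing G11) X Y)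
      (y - translMap hY (isGKModule_prod hX hY) m n μ' lam' (LinearMap.inr (GKRing G11) X Y) q) = 0 := by
    rw [map_sub, ← LinearMap.comp_apply, translMap_snd_comp_inr hX hY, LinearMap.id_apply, hq, sub_self]
  obtain ⟨p, hp⟩ := (hex _).mp hker
  exact ⟨(p, q), by rw [translCoprod_apply hX hY, hp, sub_add_cancel]⟩

/-- **`ψ(X × Y) ≅ ψX × ψY` — THE TRANSLATION FUNCTOR IS ADDITIVE**: for `(𝔤, K)`-modules `X ∈ 𝒞_{Zf}`, `Y` over the operator ring,
`(ψ(ι₁), ψ(ι₂)) : ψ^{(μ′,λ′)}_{F_{m,n}} X × ψ^{(μ′,λ′)}_{F_{m,n}} Y ≃ₗ[R] ψ^{(μ′,λ′)}_{F_{m,n}}(X × Y)`.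
[cite: KnappVogan1995, §VII.8 (7.141), Prop. 7.143] [cite: BorelWallach2000, 0 §2.5] -/
def translProdEquiv (hXZ : IsZCFinite (GKRing.actLie G11 X)) (m : ℕ) (n : ℤ) (μ' lam' : ℂ) :
    (transl hX m n μ' lam' × transl hY m n μ' lam') ≃ₗ[GKRing G11] transl (isGKModule_prod hX hY) m n μ' lam' :=
  LinearEquiv.ofBijective (translCoprod hX hY m n μ' lam') ⟨translCoprod_injective hX hY m n μ' lam', translCoprod_surjective hX hY hXZ m n μ' lam'⟩

/-- `translProdEquiv` is `translCoprod`. [cite: KnappVogan1995, §VII.8 (7.141)] -/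
@[simp] theorem translProdEquiv_apply (hXZ : IsZCFinite (GKRing.actLie G11 X)) (m : ℕ) (n : ℤ) (μ' lam' : ℂ)
    (x : transl hX m n μ' lam' × transl hY m n μ' lam') :
    translProdEquiv hX hY hXZ m n μ' lam' x = translCoprod hX hY m n μ' lam' x := rfl

/-- The inverse is `(ψ(π₁), ψ(π₂))`. [cite: KnappVogan1995, §VII.8 (7.141)] -/
theorem translProdEquiv_symm_apply (hXZ : IsZCFinite (GKRing.actLie G11 X)) (m : ℕ) (n : ℤ) (μ' lam' : ℂ)
    (y : transl (isGKModule_prod hX hY) m n μ' lam') :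
    (translProdEquiv hX hY hXZ m n μ' lam').symm y =
      (translMap (isGKModule_prod hX hY) hX m n μ' lam' (LinearMap.fst (GKRing G11) X Y) y,
        translMap (isGKModule_prod hX hY) hY m n μ' lam' (LinearMap.snd (GKRing G11) X Y) y) := by
  obtain ⟨x, rfl⟩ := (translProdEquiv hX hY hXZ m n μ' lam').surjective y
  rw [LinearEquiv.symm_apply_apply, translProdEquiv_apply]
  exact (LinearMap.congr_fun (prod_comp_translCoprod hX hY m n μ' lam') x).symm

/-- **`ℓ_R(ψ(X × Y)) = ℓ_R(ψX) + ℓ_R(ψY)`**. [cite: KnappVogan1995, §VII.8 Prop. 7.143, App. A §3] -/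
theorem length_transl_prod (hXZ : IsZCFinite (GKRing.actLie G11 X)) (m : ℕ) (n : ℤ) (μ' lam' : ℂ) :
    Module.length (GKRing G11) (transl (isGKModule_prod hX hY) m n μ' lam') =
      Module.length (GKRing G11) (transl hX m n μ' lam') + Module.length (GKRing G11) (transl hY m n μ' lam') := by
  rw [← (translProdEquiv hX hY hXZ m n μ' lam').length_eq, Module.length_prod]

end Prod

end U11TranslProd

end Literature.RepresentationTheory.BorelWallach2000
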